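import Literature.NumberTheory.GaloisRepresentations.SerreCartanNormalizerGL2Fp
import HarnessLib

/-!
# An element of a Cartan subgroup conjugating `N - C` to its negative (`ρ ≅ ρ ⊗ ε` on `N`)

Topic `NumberTheory/GaloisRepresentations`; theorems only (no definitions, no named facts), in
the vocabulary of `SerreCartanSubgroupsGL2Fp` / `SerreCartanNormalizerGL2Fp` (J.-P. Serre,
*Propriétés galoisiennes des points d'ordre fini des courbes elliptiques*, Invent. Math. 15
(1972), §2.1–2.2: `splitCartan P`, `unitGroup k`, `cartanSubgroups`, the normaliser `N` of a
Cartan subgroup `C` with `(N : C) = 2`).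

* `Serre1972.mul_comm_of_mem_cartanSubgroups` — Cartan subgroups are commutative.
* `Serre1972.halfDiagonalHom_neg_one_mul_mul` — `diag(1, -1) x diag(1, -1) = -x` for an
  antidiagonal `x`.
* `Serre1972.exists_mem_conj_eq_neg` — **for every Cartan subgroup `C ≤ GL₂(𝔽_p)`, `p` odd, there
  is `M ∈ C` with `M s M⁻¹ = -s` for all `s ∈ N - C`** (and `M` commutes with `C`).  Split case:
  `M = P diag(1, -1) P⁻¹`, the elements of `N - C` being `P (0 *; * 0) P⁻¹`
  (`mem_normalizer_splitCartan_iff`); non-split case `C = kˣ`: `M = 2y₀ - tr(y₀)` for a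
  non-scalar `y₀ ∈ k`, since conjugation by `s ∈ N - C` is the non-trivial automorphism
  `y₀ ↦ ȳ₀ = tr(y₀) - y₀` of `k` (`conj_eq_or_conj_eq_of_mem_normalizer`,
  `mem_unitGroup_of_conj_eq`), which negates the trace-zero element `y₀ - ȳ₀`.

Consequence (used for Galois images in the normaliser of a Cartan subgroup, Serre 1972 §4.2,
Masser–Wüstholz 1993 §4 case (ii)): for `G ≤ N`, `G ⊄ C`, with quadratic character
`ε : G → N/C = {±1}`, conjugation by `M` realises an isomorphism `ρ ≅ ρ ⊗ ε` of the tautological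
representation of `G` with its twist by `ε` (`Serre1972.exists_mem_forall_conj_eq_of_le_normalizer`).

## References

* [Serre1972] J.-P. Serre, Invent. Math. 15 (1972) 259–331, §2.1–2.2 (Cartan subgroups and
  their normalisers), §4.2 c) (the character `ε_ℓ : G → N_ℓ/C_ℓ`).
-/

open Matrix
open scoped MatrixGroups

namespace Literature.NumberTheory.GaloisRepresentations.Serre1972

variable {p : ℕ} [Fact p.Prime]

/-- **Cartan subgroups are commutative** (Serre 1972, §2.1: a split Cartan subgroup is
`≅ 𝔽_pˣ × 𝔽_pˣ`, a non-split one is the multiplicative group of a field `k ≅ 𝔽_{p²}`).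
[cite: Serre1972, §2.1] -/
theorem mul_comm_of_mem_cartanSubgroups {C : Subgroup (GL (Fin 2) (ZMod p))}
    (hC : C ∈ cartanSubgroups (ZMod p)) {g h : GL (Fin 2) (ZMod p)} (hg : g ∈ C) (hh : h ∈ C) :
    g * h = h * g := by
  rcases hC with ⟨P, rfl⟩ | ⟨k, hk, -, rfl⟩
  · exact mul_comm_of_mem_splitCartan hg hh
  · rw [mem_unitGroup_iff] at hg hh
    exact Units.ext (by
      simpa only [Units.val_mul, Subring.coe_mul, MulMemClass.coe_mul] using
        congrArg Subtype.val (hk.mul_comm ⟨_, hg⟩ ⟨_, hh⟩))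

/-- `diag(1, -1) x diag(1, -1) = -x` in `GL₂` for an antidiagonal `x` (the matrix of
`diag(1, -1)` is `halfDiagonalHom (-1)`). [folklore] -/
theorem halfDiagonalHom_neg_one_mul_mul {x : GL (Fin 2) (ZMod p)}
    (hx : GL2.IsAd ((x : GL (Fin 2) (ZMod p)) : Matrix (Fin 2) (Fin 2) (ZMod p))) :
    halfDiagonalHom (-1) * x * halfDiagonalHom (-1) = -x := by
  apply Units.ext
  simp only [Units.val_mul, Units.val_neg, coe_halfDiagonalHom, Units.val_neg, Units.val_one]
  ext i j
  fin_cases i <;> fin_cases j <;>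
    simp [Matrix.mul_apply, Matrix.diagonal, hx.1, hx.2]

/-- **An element of `C` conjugating `N - C` to its negative.**  Let `p` be an odd prime and `C` a
Cartan subgroup of `GL₂(𝔽_p)` with normaliser `N`.  There is `M ∈ C` with `M s M⁻¹ = -s` for every
`s ∈ N - C`.  (Split: `M = P diag(1,-1) P⁻¹`; non-split `C = kˣ`: `M = 2y₀ - tr(y₀) ∈ k` for a
non-scalar `y₀ ∈ k`, on which `s ∈ N - C` acts by `y₀ ↦ tr(y₀) - y₀`.) Since `C` is commutative,
`M` commutes with `C`; so for `G ≤ N` conjugation by `M` multiplies `g ∈ G` by the value `±1` of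
the quadratic character `G → N/C`. [cite: Serre1972, §2.2] -/
theorem exists_mem_conj_eq_neg (hp2 : p ≠ 2) {C : Subgroup (GL (Fin 2) (ZMod p))}
    (hC : C ∈ cartanSubgroups (ZMod p)) :
    ∃ M ∈ C, ∀ s ∈ Subgroup.normalizer (C : Set (GL (Fin 2) (ZMod p))), s ∉ C →
      M * s * M⁻¹ = -s := by
  rcases hC with ⟨P, rfl⟩ | ⟨k, hk, h2, rfl⟩
  · -- split Cartan subgroup `P (* 0; 0 *) P⁻¹`
    set D : GL (Fin 2) (ZMod p) := halfDiagonalHom (-1) with hD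
    have hDD : D * D = 1 := by rw [hD, ← map_mul, neg_one_mul, neg_neg, map_one]
    refine ⟨P * D * P⁻¹, ?_, fun s hs hsC ↦ ?_⟩
    · rw [mem_splitCartan_iff, show P⁻¹ * (P * D * P⁻¹) * P = D by group, hD,
        coe_halfDiagonalHom]
      exact ⟨by simp, by simp⟩
    · have hx : GL2.IsAd ((P⁻¹ * s * P : GL (Fin 2) (ZMod p)) : Matrix (Fin 2) (Fin 2) (ZMod p)) :=
        ((mem_normalizer_splitCartan_iff (exists_units_ne_one hp2)).mp hs).resolve_left
          fun h ↦ hsC (mem_splitCartan_iff.mpr h)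
      have key : D * (P⁻¹ * s * P) * D = -(P⁻¹ * s * P) := halfDiagonalHom_neg_one_mul_mul hx
      have hMM : P * D * P⁻¹ * (P * D * P⁻¹) = 1 := by
        calc P * D * P⁻¹ * (P * D * P⁻¹) = P * (D * D) * P⁻¹ := by group
          _ = 1 := by rw [hDD]; group
      rw [inv_eq_of_mul_eq_one_right hMM]
      calc P * D * P⁻¹ * s * (P * D * P⁻¹) = P * (D * (P⁻¹ * s * P) * D) * P⁻¹ := by group
        _ = P * (-(P⁻¹ * s * P)) * P⁻¹ := by rw [key]
        _ = -s := by rw [mul_neg, neg_mul]; congr 1; group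
  · -- non-split Cartan subgroup `kˣ`
    obtain ⟨y₀, hy₀, hys⟩ := exists_mem_forall_ne_smul_one h2
    set m : Matrix (Fin 2) (Fin 2) (ZMod p) := (2 : ZMod p) • y₀ - y₀.trace • 1 with hm
    have hmk : m ∈ k := k.sub_mem (k.smul_mem hy₀ _) (k.smul_mem k.one_mem _)
    have htwo : (2 : ZMod p) ≠ 0 := DeligneSerre1974.two_ne_zero_of_ne_two hp2
    have hm0 : m ≠ 0 := by
      intro h0
      apply hys (2⁻¹ * y₀.trace)
      have : (2 : ZMod p) • y₀ = y₀.trace • (1 : Matrix (Fin 2) (Fin 2) (ZMod p)) :=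
        sub_eq_zero.mp h0
      calc y₀ = (2 : ZMod p)⁻¹ • ((2 : ZMod p) • y₀) := by
            rw [smul_smul, inv_mul_cancel₀ htwo, one_smul]
        _ = (2⁻¹ * y₀.trace) • 1 := by rw [this, smul_smul]
    have hdet : m.det ≠ 0 := det_ne_zero_of_isField hk hmk hm0
    refine ⟨GeneralLinearGroup.mkOfDetNeZero m hdet, hmk, fun s hs hsC ↦ ?_⟩
    -- conjugation by `s` is `y₀ ↦ tr(y₀) - y₀` on `k`, hence negates `m`
    have hconj : (s : Matrix (Fin 2) (Fin 2) (ZMod p)) * y₀ * (s : Matrix (Fin 2) (Fin 2) (ZMod p))⁻¹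
        = y₀.trace • 1 - y₀ :=
      (conj_eq_or_conj_eq_of_mem_normalizer hk hy₀ hys hs).resolve_left
        fun h ↦ hsC (mem_unitGroup_of_conj_eq hy₀ hys h)
    have hsu : IsUnit (s : Matrix (Fin 2) (Fin 2) (ZMod p)).det := (GL2.det_ne_zero s).isUnit
    have hconjm : (s : Matrix (Fin 2) (Fin 2) (ZMod p)) * m *
        (s : Matrix (Fin 2) (Fin 2) (ZMod p))⁻¹ = -m := by
      rw [hm, Matrix.mul_sub, Matrix.sub_mul, Matrix.mul_smul, Matrix.smul_mul, hconj,
        Matrix.mul_smul, Matrix.smul_mul, Matrix.mul_one, Matrix.mul_nonsing_inv _ hsu]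
      rw [smul_sub, neg_sub, smul_smul, two_mul, add_smul]
      abel
    -- `s m s⁻¹ = -m` gives `m s m⁻¹ = -s`
    apply Units.ext
    have hval : ((GeneralLinearGroup.mkOfDetNeZero m hdet : GL (Fin 2) (ZMod p)) :
        Matrix (Fin 2) (Fin 2) (ZMod p)) = m := rfl
    simp only [Units.val_mul, Units.val_neg, Matrix.coe_units_inv, hval]
    have hmu : IsUnit m.det := hdet.isUnit
    have hsm : (s : Matrix (Fin 2) (Fin 2) (ZMod p)) * m = -(m * s) := by
      calc (s : Matrix (Fin 2) (Fin 2) (ZMod p)) * m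
          = (s : Matrix (Fin 2) (Fin 2) (ZMod p)) * m * (s : Matrix (Fin 2) (Fin 2) (ZMod p))⁻¹ * s :=
            (Matrix.nonsing_inv_mul_cancel_right _ _ hsu).symm
        _ = -(m * s) := by rw [hconjm, neg_mul]
    calc m * (s : Matrix (Fin 2) (Fin 2) (ZMod p)) * m⁻¹
        = -((s : Matrix (Fin 2) (Fin 2) (ZMod p)) * m) * m⁻¹ := by rw [hsm, neg_neg]
      _ = -(s : Matrix (Fin 2) (Fin 2) (ZMod p)) := by
          rw [neg_mul, Matrix.mul_nonsing_inv_cancel_right _ _ hmu]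

/-- **`ρ ≅ ρ ⊗ ε` for a subgroup of the normaliser of a Cartan subgroup.**  Let `p` be odd, `C` a
Cartan subgroup of `GL₂(𝔽_p)` and `G ≤ N(C)`.  There is `M ∈ C` such that `M g M⁻¹ = g` for
`g ∈ G ∩ C` and `M g M⁻¹ = -g` for `g ∈ G - C`: conjugation by `M` intertwines the inclusion
`G ≤ GL₂(𝔽_p)` with its twist by the quadratic character `ε : G → N/C = {±1}`
(Serre 1972, §4.2 c): `ε_ℓ`; this is the identity `E[ℓ] ≅ E[ℓ] ⊗ ε_ℓ` behind the comparison
of `E` with its quadratic twist by `ε_ℓ`). [cite: Serre1972, §2.2 and §4.2 c)] -/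
theorem exists_mem_forall_conj_eq_of_le_normalizer (hp2 : p ≠ 2)
    {C G : Subgroup (GL (Fin 2) (ZMod p))} (hC : C ∈ cartanSubgroups (ZMod p))
    (hGN : G ≤ Subgroup.normalizer (C : Set (GL (Fin 2) (ZMod p)))) :
    ∃ M ∈ C, (∀ g ∈ G, g ∈ C → M * g * M⁻¹ = g) ∧ ∀ g ∈ G, g ∉ C → M * g * M⁻¹ = -g := by
  obtain ⟨M, hMC, hM⟩ := exists_mem_conj_eq_neg hp2 hC
  refine ⟨M, hMC, fun g _ hgC ↦ ?_, fun g hg hgC ↦ hM g (hGN hg) hgC⟩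
  rw [mul_comm_of_mem_cartanSubgroups hC hMC hgC, mul_inv_cancel_right]

end Literature.NumberTheory.GaloisRepresentations.Serre1972
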